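import Summits.BirchSwinnertonDyer.BirchSwinnertonDyer.Theorems.UniversalToricDescentSigmaCongruenceAtThreeIffInvariantPair
import Summits.BirchSwinnertonDyer.BirchSwinnertonDyer.Theorems.UniversalToricDescentSelfMuZeroAtThree
import HarnessLib

/-!
# NODE g16 on crux A = `SigmaCongruenceAtThree` (stmt-BirchSwinnertonDyer-27120, route `UniversalToricDescent`, r201):
# `wild-frame-audit` — the NEGATION / VACUITY lens on A, TYPED: A is decided by three typed statements about the
# `R₀`-frames of the wild form `f_E` ALONE plus the Σ-depleted λ-identity, with kernel-checked deciders

Crux-ideate standing cover, generation 16 (planner-cruxidea-stmt-BirchSwinnertonDyer-27120-1-g16-0, kit 0, 2026-08-31).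
Parent ♭T≤ = `DefectTransportModThreePT` (stmt-23042 / 26975). BSD is not advanced by this file; it closes NOTHING of A.
It records, as checked implications, WHERE a refutation or a vacuous proof of A could come from, and shows that two of
the three doors are already shut by print-by-name facts in the tree.

## The audit (frame rigidity ⇒ every invariant of A is an invariant of `f_E`, `f_{E′}`)

Two `R₀`-frames of ONE form at `(ι′, 𝔭, κ, γ)` with ARBITRARY non-zero periods generate the same ideal of `R₀⟦T⟧`
(`UniversalToricDescentTwinSplit.span_singleton_eq_of_isBDPLFunction`, any prime). Hence `μ` and `λ` of "the" BDP
`3`-adic `L`-function of `f_E` are invariants of `f_E` (not of the frame), and A — which quantifies over ALL frames —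
can only be: (V) VACUOUSLY TRUE (no `R₀`-frame of `f_E` exists for any O6 instance: `NoWildFrameAtThree`);
(F_μ) FALSE because some frame of `f_E` has `μ > 0` (then every frame has; A forces `μ(𝓛) = 0`, p705895 §4);
(F_λ) FALSE because the Σ-depleted λ-identity fails for some `3`-congruent twin (`¬ LambdaIdentityAtThree`);
(T) TRUE with content = the λ-identity. The deciders below are: (V) ⇒ A (`sigmaCongruenceAtThree_of_noWildFrame`);
A ⇒ λ-identity unconditionally (`lambdaIdentityAtThree_of_sigmaCongruenceAtThree`), so (F_λ) ⇒ ¬A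
(`not_sigmaCongruenceAtThree_of_not_lambdaIdentityAtThree`); `μ = 0` for every wild frame + λ-identity ⇒ A
(`sigmaCongruenceAtThree_of_muZero_of_lambdaIdentity`), i.e. A ⟺ λ-identity granted `WildFrameMuZeroAtThree`
(`sigmaCongruenceAtThree_iff_lambdaIdentityAtThree_of_muZero`, the tree's §5 with the print fact replaced by the typed
statement it is used for); and door (F_μ) is SHUT by print: `WildFrameMuZeroAtThree` follows from the refereed named fact
Hsieh 2014 Thm. B at every level (item 27933) — `wildFrameMuZeroAtThree_of_thmB` (= utd-p1 g4's self-`μ` theorem).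
Door (V) is governed by `WildFrameExistsAtThree` (an `R₀`-frame with a unit coefficient exists: the `R₀`-DESCENT of
Hsieh's `𝒪_{ℂ_3}⟦T⟧`-valued element at `27 ∣ N`, the residual (LB-exist) named in
`Literature/…/Hsieh2014/AnticyclotomicPAdicLFunctionAnyLevel.lean`; the tree has the ♭-frame
`UniversalToricDescentSelfMuZero.self_exists_isBDPLFunctionInt_coeff_norm_eq_one` from 27933, not the `R₀`-frame).

## Pieces (tags per D-0171)

* V  `NoWildFrameAtThree` — vacuity shape. UNDECIDED; its negation on one instance is (LB-exist). Leaf: ATTACKABLE at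
     route level (`R₀`-descent of Hsieh's `Q`; typer/prover work, not ideation). Decider V ⇒ A PROVED.
* E  `WildFrameExistsAtThree` — (LB-exist) in `R₀`-currency with `μ = 0`. UNDECIDED · ATTACKABLE (same leaf).
* M  `WildFrameMuZeroAtThree` — `μ = 0` for every `R₀`-frame of `f_E`. WEAKER than print: PROVED from 27933
     (`wildFrameMuZeroAtThree_of_thmB`). Door (F_μ) shut.
* Λ  `LambdaIdentityAtThree` — the Σ-depleted λ-identity (p705895 §5's right-hand side, verbatim). EQUIVALENT to A
     granted M (kernel), hence the WHOLE research content of A. UNDECIDED · ATTACKABLE by the port P2 of g15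
     (`NodeNguyenEpwWildPort.SigmaCongruenceOfCongruentExpansions`) · INSTRUMENTABLE (ask I2 / I-g14: λ of the two
     Σ-depleted frames for one O6 pair; a mismatch is ¬A by `not_sigmaCongruenceAtThree_of_not_lambdaIdentityAtThree`).

HONEST STATUS: no `sorry`; no new definition beyond the four `Prop`s; no named fact minted; every theorem is assembled
from p705895 (§4–§5), utd-p1 g4 (self-`μ`) and logic. References: [Hsieh2014] Thm. B; [GreenbergVatsal2000] (1.5), (9),
Prop. (2.4); [Castella2018] Thm. 3.1; [Washington1997] §7.1.
-/

set_option linter.dupNamespace false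
set_option autoImplicit false

noncomputable section

open scoped Classical NumberField
open NumberField IsDedekindDomain Field PowerSeries
open Literature.NumberTheory.EllipticCurves Literature.NumberTheory.EllipticCurves.GreenbergVatsal2000
  Literature.NumberTheory.EllipticCurves.ModularForms
  Summit.BirchSwinnertonDyer.BirchSwinnertonDyer.Theorems
  Summit.BirchSwinnertonDyer.BirchSwinnertonDyer.Theorems.UniversalToricDescentSigmaCongruenceInvariantPair
  Summit.BirchSwinnertonDyer.BirchSwinnertonDyer.Theses.UniversalToricDescent

namespace Summit.BirchSwinnertonDyer.BirchSwinnertonDyer.Cruxes.SigmaCongruenceAtThree.WildFrameAudit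

/-! ### §1 The four typed statements -/

/-- **V (vacuity shape).** For every O6 instance of A's `E`-side telescope, NO `R₀`-frame of `f_E` exists at
`(ι′, 𝔭, κ, γ)`. If true, A holds vacuously (§2); its failure on one instance is (LB-exist). UNDECIDED.
[cite: Castella2018, Thm. 3.1 (the frame predicate, `p ≥ 5`)] [cite: Hsieh2014, Thm. A–B (the `𝒪_{ℂ_p}`-valued element)] -/
def NoWildFrameAtThree : Prop :=
  ∀ (W : WeierstrassCurve ℚ) [W.IsElliptic] [W.IsGloballyMinimal]
    (N : ℕ) [NeZero N] (K : Type) [Field K] [NumberField K]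
    (Dt : Literature.NumberTheory.EllipticCurves.ModularForms.ModularParametrizationData W N),
    Summit.BirchSwinnertonDyer.Rank1Residual.Additive.ClassO6 W 3 → W.HasSurjectiveModNGaloisRep 3 →
    W.analyticRank = 1 → W.conductorNorm ℤ = N →
    Literature.NumberTheory.EllipticCurves.IsImaginaryQuadratic K →
    Literature.NumberTheory.EllipticCurves.SatisfiesHeegnerHypothesis N K →
    ∀ (κ : Literature.NumberTheory.EllipticCurves.ZpExtension K 3), κ.IsAnticyclotomic →
      ∀ (γ : Field.absoluteGaloisGroup K) [Fact (κ.IsTopGenerator γ)]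
        (𝔭 : IsDedekindDomain.HeightOneSpectrum (NumberField.RingOfIntegers K)),
        ((3 : ℕ) : NumberField.RingOfIntegers K) ∈ 𝔭.asIdeal →
        𝔭.asIdeal.ramificationIdx (NumberField.RingOfIntegers ℚ) = 1 →
        𝔭.asIdeal.inertiaDeg (NumberField.RingOfIntegers ℚ) = 1 →
        ∀ (ι' : PadicAlgCl 3 ≃+* ℂ),
          Summit.BirchSwinnertonDyer.BirchSwinnertonDyer.Theorems.SchneiderFree.BranchInducesPrime 3 ι' 𝔭 →
          ∀ (ΩK : ℂ) (Ωp : ℂ_[3]) (L : Literature.NumberTheory.EllipticCurves.UnrSeries 3), ΩK ≠ 0 → Ωp ≠ 0 →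
            ¬ Literature.NumberTheory.EllipticCurves.IsBDPLFunction ι' 𝔭 κ γ Dt.f ΩK Ωp L

/-- **E (LB-exist in `R₀`-currency).** For every O6 instance, SOME `R₀`-frame of `f_E` with a norm-one coefficient
exists. The `R₀`-descent of Hsieh's element; the tree has only the ♭-frame (`𝒪_{ℂ_3}⟦T⟧`) from item 27933. UNDECIDED.
[cite: Hsieh2014, Thm. B p. 712 (Doc. Math. 19)] [cite: Castella2018, Thm. 3.1] -/
def WildFrameExistsAtThree : Prop :=
  ∀ (W : WeierstrassCurve ℚ) [W.IsElliptic] [W.IsGloballyMinimal]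
    (N : ℕ) [NeZero N] (K : Type) [Field K] [NumberField K]
    (Dt : Literature.NumberTheory.EllipticCurves.ModularForms.ModularParametrizationData W N),
    Summit.BirchSwinnertonDyer.Rank1Residual.Additive.ClassO6 W 3 → W.HasSurjectiveModNGaloisRep 3 →
    W.analyticRank = 1 → W.conductorNorm ℤ = N →
    Literature.NumberTheory.EllipticCurves.IsImaginaryQuadratic K →
    Literature.NumberTheory.EllipticCurves.SatisfiesHeegnerHypothesis N K →
    ∀ (κ : Literature.NumberTheory.EllipticCurves.ZpExtension K 3), κ.IsAnticyclotomic →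
      ∀ (γ : Field.absoluteGaloisGroup K) [Fact (κ.IsTopGenerator γ)]
        (𝔭 : IsDedekindDomain.HeightOneSpectrum (NumberField.RingOfIntegers K)),
        ((3 : ℕ) : NumberField.RingOfIntegers K) ∈ 𝔭.asIdeal →
        𝔭.asIdeal.ramificationIdx (NumberField.RingOfIntegers ℚ) = 1 →
        𝔭.asIdeal.inertiaDeg (NumberField.RingOfIntegers ℚ) = 1 →
        ∀ (ι' : PadicAlgCl 3 ≃+* ℂ),
          Summit.BirchSwinnertonDyer.BirchSwinnertonDyer.Theorems.SchneiderFree.BranchInducesPrime 3 ι' 𝔭 →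
          ∃ (ΩK : ℂ) (Ωp : ℂ_[3]) (L : Literature.NumberTheory.EllipticCurves.UnrSeries 3), ΩK ≠ 0 ∧ Ωp ≠ 0 ∧
            Literature.NumberTheory.EllipticCurves.IsBDPLFunction ι' 𝔭 κ γ Dt.f ΩK Ωp L ∧
            ∃ i : ℕ, ‖((PowerSeries.coeff i L : Literature.NumberTheory.EllipticCurves.unrIntegers 3) : ℂ_[3])‖ = 1

/-- **M (`μ = 0` for every wild frame).** On A's `E`-side telescope (idle binders `𝔭′` kept, verbatim the conclusion
of utd-p1 g4's `UniversalToricDescentSelfMuZero.self_forall_isBDPLFunction_coeff_norm_eq_one` WITHOUT its print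
hypothesis): every `R₀`-frame of `f_E` has a coefficient of norm one. PROVED from item 27933 in §3.
[cite: Hsieh2014, Thm. B p. 712 (Doc. Math. 19) = Thm. 2 (arXiv:1112.1580 p. 4)] -/
def WildFrameMuZeroAtThree : Prop :=
  ∀ (W : WeierstrassCurve ℚ) [W.IsElliptic] [W.IsGloballyMinimal]
    (N : ℕ) [NeZero N] (K : Type) [Field K] [NumberField K]
    (Dt : Literature.NumberTheory.EllipticCurves.ModularForms.ModularParametrizationData W N),
    Summit.BirchSwinnertonDyer.Rank1Residual.Additive.ClassO6 W 3 → W.HasSurjectiveModNGaloisRep 3 →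
    W.analyticRank = 1 → W.conductorNorm ℤ = N →
    Literature.NumberTheory.EllipticCurves.IsImaginaryQuadratic K →
    Literature.NumberTheory.EllipticCurves.SatisfiesHeegnerHypothesis N K →
    ∀ (κ : Literature.NumberTheory.EllipticCurves.ZpExtension K 3), κ.IsAnticyclotomic →
      ∀ (γ : Field.absoluteGaloisGroup K) [Fact (κ.IsTopGenerator γ)]
        (𝔭 : IsDedekindDomain.HeightOneSpectrum (NumberField.RingOfIntegers K)),
        ((3 : ℕ) : NumberField.RingOfIntegers K) ∈ 𝔭.asIdeal →
        𝔭.asIdeal.ramificationIdx (NumberField.RingOfIntegers ℚ) = 1 →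
        𝔭.asIdeal.inertiaDeg (NumberField.RingOfIntegers ℚ) = 1 →
        ∀ (𝔭' : IsDedekindDomain.HeightOneSpectrum (NumberField.RingOfIntegers K)),
        ((3 : ℕ) : NumberField.RingOfIntegers K) ∈ 𝔭'.asIdeal → 𝔭' ≠ 𝔭 →
        ∀ (ι' : PadicAlgCl 3 ≃+* ℂ),
          Summit.BirchSwinnertonDyer.BirchSwinnertonDyer.Theorems.SchneiderFree.BranchInducesPrime 3 ι' 𝔭 →
          ∀ (ΩK : ℂ) (Ωp : ℂ_[3]) (L : Literature.NumberTheory.EllipticCurves.UnrSeries 3), ΩK ≠ 0 → Ωp ≠ 0 →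
            Literature.NumberTheory.EllipticCurves.IsBDPLFunction ι' 𝔭 κ γ Dt.f ΩK Ωp L →
            ∃ i : ℕ, ‖((PowerSeries.coeff i L : Literature.NumberTheory.EllipticCurves.unrIntegers 3) :
              ℂ_[3])‖ = 1

/-- **Λ (the Σ-depleted λ-identity).** On A's binders: for all norm profiles `m` of `𝓛` and `m′` of `𝓛′`,
`m + Σ_{v∈T} 3^{c_v}·d_v(E_K) = m′ + Σ_{v∈T} 3^{c_v}·d_v(E′_K)` (`d_v` = multiplicity of `q_v⁻¹` as a root of the
reduced Euler factor) — VERBATIM the right-hand side of p705895 §5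
`sigmaCongruenceAtThree_iff_lambdaIdentity_of_thmB`, i.e. `λ(𝓛^Σ_E) = λ(𝓛^Σ_{E′})`. UNDECIDED (the research content).
[cite: GreenbergVatsal2000, Thm. (1.5), §1 display (9), §2 Prop. (2.4)] [cite: LeiMullerXia2023, Cor. 3.8, Thm. B] -/
def LambdaIdentityAtThree : Prop :=
  ∀ (W : WeierstrassCurve ℚ) [W.IsElliptic] [W.IsGloballyMinimal] (W' : WeierstrassCurve ℚ) [W'.IsElliptic]
      [W'.IsGloballyMinimal] (N N' : ℕ) [NeZero N] [NeZero N'] (K : Type) [Field K] [NumberField K] (Dt :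
      Literature.NumberTheory.EllipticCurves.ModularForms.ModularParametrizationData W N) (Dt' :
      Literature.NumberTheory.EllipticCurves.ModularForms.ModularParametrizationData W' N'),
      Summit.BirchSwinnertonDyer.Rank1Residual.Additive.ClassO6 W 3 → W.HasSurjectiveModNGaloisRep 3 →
      W.analyticRank = 1 → W.conductorNorm ℤ = N → Summit.BirchSwinnertonDyer.Rank1Residual.O6.ModPCongruent W' W
      3 → ¬ Literature.NumberTheory.EllipticCurves.Rank1Residual.Addv W' 3 → W'.conductorNorm ℤ = N' →
      Literature.NumberTheory.EllipticCurves.IsImaginaryQuadratic K →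
      Literature.NumberTheory.EllipticCurves.SatisfiesHeegnerHypothesis N K →
      Literature.NumberTheory.EllipticCurves.SatisfiesHeegnerHypothesis N' K → ∀ (κ :
      Literature.NumberTheory.EllipticCurves.ZpExtension K 3), κ.IsAnticyclotomic → ∀ (γ :
      Field.absoluteGaloisGroup K) [Fact (κ.IsTopGenerator γ)] (𝔭 : IsDedekindDomain.HeightOneSpectrum
      (NumberField.RingOfIntegers K)), ((3 : ℕ) : NumberField.RingOfIntegers K) ∈ 𝔭.asIdeal →
      𝔭.asIdeal.ramificationIdx (NumberField.RingOfIntegers ℚ) = 1 → 𝔭.asIdeal.inertiaDeg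
      (NumberField.RingOfIntegers ℚ) = 1 → ∀ (𝔭' : IsDedekindDomain.HeightOneSpectrum (NumberField.RingOfIntegers
      K)), ((3 : ℕ) : NumberField.RingOfIntegers K) ∈ 𝔭'.asIdeal → 𝔭' ≠ 𝔭 → ∀ (ι' : PadicAlgCl 3 ≃+* ℂ),
      Summit.BirchSwinnertonDyer.BirchSwinnertonDyer.Theorems.SchneiderFree.BranchInducesPrime 3 ι' 𝔭 → ∀ (ΩK : ℂ)
      (Ωp : ℂ_[3]) (L : Literature.NumberTheory.EllipticCurves.UnrSeries 3), ΩK ≠ 0 → Ωp ≠ 0 →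
      Literature.NumberTheory.EllipticCurves.IsBDPLFunction ι' 𝔭 κ γ Dt.f ΩK Ωp L → ∀ (ΩK' : ℂ) (Ωp' : ℂ_[3]) (L'
      : Literature.NumberTheory.EllipticCurves.UnrSeries 3), ΩK' ≠ 0 → Ωp' ≠ 0 →
      Literature.NumberTheory.EllipticCurves.IsBDPLFunction ι' 𝔭 κ γ Dt'.f ΩK' Ωp' L' → (∃ i : ℕ,
      ‖((PowerSeries.coeff i L' : Literature.NumberTheory.EllipticCurves.unrIntegers 3) : ℂ_[3])‖ = 1) → ∀ (T :
      Finset (IsDedekindDomain.HeightOneSpectrum (NumberField.RingOfIntegers K))) (c :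
      IsDedekindDomain.HeightOneSpectrum (NumberField.RingOfIntegers K) → ℕ), (↑T = {v :
      IsDedekindDomain.HeightOneSpectrum (NumberField.RingOfIntegers K) | ((3 : ℕ) : NumberField.RingOfIntegers K)
      ∉ v.asIdeal ∧ (¬ (W.baseChange K).HasGoodReductionAt v ∨ ¬ (W'.baseChange K).HasGoodReductionAt v)}) → (∀ v
      ∈ T, (∃ d₀ : Literature.NumberTheory.EllipticCurves.GreenbergSelmer.decomp (K := K) v, (κ (d₀ :
      Field.absoluteGaloisGroup K)).toAdd = (3 : ℤ_[3]) ^ c v) ∧ (∀ d :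
      Literature.NumberTheory.EllipticCurves.GreenbergSelmer.decomp (K := K) v, (3 : ℤ_[3]) ^ c v ∣ (κ (d :
      Field.absoluteGaloisGroup K)).toAdd)) →
      ∀ m m' : ℕ,
        ((∀ i < m, ‖((PowerSeries.coeff i L : unrIntegers 3) : ℂ_[3])‖ < 1) ∧
          ‖((PowerSeries.coeff m L : unrIntegers 3) : ℂ_[3])‖ = 1) →
        ((∀ i < m', ‖((PowerSeries.coeff i L' : unrIntegers 3) : ℂ_[3])‖ < 1) ∧
          ‖((PowerSeries.coeff m' L' : unrIntegers 3) : ℂ_[3])‖ = 1) →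
        m + ∑ v ∈ T, 3 ^ c v * (eulerFactorModP (W.baseChange K) 3 v).rootMultiplicity
              (((Nat.card (IsLocalRing.ResidueField (v.adicCompletionIntegers K)) : ℕ) : ZMod 3)⁻¹) =
          m' + ∑ v ∈ T, 3 ^ c v * (eulerFactorModP (W'.baseChange K) 3 v).rootMultiplicity
              (((Nat.card (IsLocalRing.ResidueField (v.adicCompletionIntegers K)) : ℕ) : ZMod 3)⁻¹)

/-! ### §2 Door (V): vacuity decides A -/

set_option maxHeartbeats 800000 in
/-- **If no `R₀`-frame of the wild form exists, A holds (vacuously).** The crux quantifies over frames `𝓛` of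
`f_E`; under V there are none. [cite: Castella2018, Thm. 3.1 (arXiv:1704.06608 p. 9)] -/
theorem sigmaCongruenceAtThree_of_noWildFrame (hV : NoWildFrameAtThree) : SigmaCongruenceAtThree := by
  unfold SigmaCongruenceAtThree
  intro W _ _ W' _ _ N N' _ _ K _ _ Dt Dt' hO6 hsurj hrk hN _hmod _haddv _hN' hK hH _hH' κ hκ γ _ 𝔭 h𝔭 hram
    hdeg 𝔭' _h𝔭' _hne ι' hι ΩK Ωp L hΩK hΩp hL
  exact absurd hL (hV W N K Dt hO6 hsurj hrk hN hK hH κ hκ γ 𝔭 h𝔭 hram hdeg ι' hι ΩK Ωp L hΩK hΩp)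

/-! ### §3 Door (F_μ) is shut by print: `μ = 0` for every wild frame from Hsieh Thm. B (item 27933) -/

/-- **M from print, by name** — utd-p1 g4's self-`μ` theorem restated as an implication between named statements:
the refereed fact `Hsieh2014.thmB_exists_isHsiehLFunction_coeff_norm_eq_one_unrPeriod_anyLevel` (item 27933,
Doc. Math. 19 (2014) Thm. B at every level) gives `WildFrameMuZeroAtThree`. So A cannot fail for `μ`-reasons.
[cite: Hsieh2014, Thm. B p. 712 (Doc. Math. 19) = Thm. 2 (arXiv:1112.1580 p. 4 ll. 31–38)]
[cite: Castella2018, Thm. 3.1 (arXiv:1704.06608 p. 9)] -/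
theorem wildFrameMuZeroAtThree_of_thmB
    (hB : Hsieh2014.thmB_exists_isHsiehLFunction_coeff_norm_eq_one_unrPeriod_anyLevel) :
    WildFrameMuZeroAtThree :=
  fun W _ _ N _ K _ _ Dt hO6 hsurj hrk hN hK hH κ hκ γ _ 𝔭 h𝔭 hram hdeg 𝔭' h𝔭' hne ι' hι ΩK Ωp L hΩK hΩp hL ↦
    UniversalToricDescentSelfMuZero.self_forall_isBDPLFunction_coeff_norm_eq_one hB W N K Dt hO6 hsurj hrk hN hK
      hH κ hκ γ 𝔭 h𝔭 hram hdeg 𝔭' h𝔭' hne ι' hι ΩK Ωp L hΩK hΩp hL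

/-- **E ⇒ ¬V on any instance is immediate; recorded as: E and V cannot both hold once ONE O6 instance of the
telescope is inhabited.** (Typed as: under E, V implies that every instance's frame refutes itself — so V ⇒ the
telescope is empty.) [folklore] -/
theorem noWildFrame_imp_telescope_empty (hE : WildFrameExistsAtThree) (hV : NoWildFrameAtThree) :
    ∀ (W : WeierstrassCurve ℚ) [W.IsElliptic] [W.IsGloballyMinimal]
      (N : ℕ) [NeZero N] (K : Type) [Field K] [NumberField K]
      (Dt : Literature.NumberTheory.EllipticCurves.ModularForms.ModularParametrizationData W N),
      Summit.BirchSwinnertonDyer.Rank1Residual.Additive.ClassO6 W 3 → W.HasSurjectiveModNGaloisRep 3 →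
      W.analyticRank = 1 → W.conductorNorm ℤ = N →
      Literature.NumberTheory.EllipticCurves.IsImaginaryQuadratic K →
      Literature.NumberTheory.EllipticCurves.SatisfiesHeegnerHypothesis N K →
      ∀ (κ : Literature.NumberTheory.EllipticCurves.ZpExtension K 3), κ.IsAnticyclotomic →
        ∀ (γ : Field.absoluteGaloisGroup K) [Fact (κ.IsTopGenerator γ)]
          (𝔭 : IsDedekindDomain.HeightOneSpectrum (NumberField.RingOfIntegers K)),
          ((3 : ℕ) : NumberField.RingOfIntegers K) ∈ 𝔭.asIdeal →
          𝔭.asIdeal.ramificationIdx (NumberField.RingOfIntegers ℚ) = 1 →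
          𝔭.asIdeal.inertiaDeg (NumberField.RingOfIntegers ℚ) = 1 →
          ∀ (ι' : PadicAlgCl 3 ≃+* ℂ),
            ¬ Summit.BirchSwinnertonDyer.BirchSwinnertonDyer.Theorems.SchneiderFree.BranchInducesPrime 3 ι' 𝔭 := by
  intro W _ _ N _ K _ _ Dt hO6 hsurj hrk hN hK hH κ hκ γ _ 𝔭 h𝔭 hram hdeg ι' hι
  obtain ⟨ΩK, Ωp, L, hΩK, hΩp, hL, -⟩ := hE W N K Dt hO6 hsurj hrk hN hK hH κ hκ γ 𝔭 h𝔭 hram hdeg ι' hι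
  exact hV W N K Dt hO6 hsurj hrk hN hK hH κ hκ γ 𝔭 h𝔭 hram hdeg ι' hι ΩK Ωp L hΩK hΩp hL

/-! ### §4 Door (F_λ) and the positive door (T): A versus the λ-identity -/

set_option maxHeartbeats 800000 in
/-- **A ⇒ Λ, unconditionally** (p705895 §4 (→) and uniqueness of norm profiles; no print needed). Contrapositive:
a single `3`-congruent twin with `λ(𝓛^Σ_E) ≠ λ(𝓛^Σ_{E′})` REFUTES A (§4, next theorem).
[cite: GreenbergVatsal2000, Thm. (1.5), §1 display (9)] [cite: Washington1997, §7.1] -/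
theorem lambdaIdentityAtThree_of_sigmaCongruenceAtThree (hA : SigmaCongruenceAtThree) : LambdaIdentityAtThree := by
  haveI : Fact (Nat.Prime 3) := ⟨Nat.prime_three⟩
  have hIP := sigmaCongruenceAtThree_iff_invariantPair.mp hA
  intro W _ _ W' _ _ N N' _ _ K _ _ Dt Dt' hO6 hsurj hrk hN hmod haddv hN' hK hH hH' κ hκ γ _ 𝔭 h𝔭 hram
    hdeg 𝔭' h𝔭' hne ι' hι ΩK Ωp L hΩK hΩp hL ΩK' Ωp' L' hΩK' hΩp' hL' hi' T c hT hc m m' hm hm'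
  obtain ⟨m₀, m₀', hm₀, hm₀', hsum⟩ := hIP W W' N N' K Dt Dt' hO6 hsurj hrk hN hmod haddv hN' hK hH hH' κ hκ γ
    𝔭 h𝔭 hram hdeg 𝔭' h𝔭' hne ι' hι ΩK Ωp L hΩK hΩp hL ΩK' Ωp' L' hΩK' hΩp' hL' hi' T c hT hc
  rw [UniversalToricDescentSelfMuZero.normProfile_unique hm hm₀,
    UniversalToricDescentSelfMuZero.normProfile_unique hm' hm₀']
  exact hsum

/-- **Door (F_λ): a failure of the λ-identity refutes A.** [cite: GreenbergVatsal2000, Thm. (1.5)] -/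
theorem not_sigmaCongruenceAtThree_of_not_lambdaIdentityAtThree (h : ¬ LambdaIdentityAtThree) :
    ¬ SigmaCongruenceAtThree :=
  fun hA ↦ h (lambdaIdentityAtThree_of_sigmaCongruenceAtThree hA)

set_option maxHeartbeats 800000 in
/-- **Door (T): `μ = 0` for every wild frame + the λ-identity ⇒ A** (p705895 §4 (←) with the profile of `𝓛`
supplied by M instead of by the print fact, and the profile of `𝓛′` by A's hypothesis `μ(𝓛′) = 0`).
[cite: GreenbergVatsal2000, Thm. (1.5), §1 display (9), §2 Prop. (2.4)] [cite: Washington1997, §7.1] -/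
theorem sigmaCongruenceAtThree_of_muZero_of_lambdaIdentity (hM : WildFrameMuZeroAtThree)
    (hΛ : LambdaIdentityAtThree) : SigmaCongruenceAtThree := by
  haveI : Fact (Nat.Prime 3) := ⟨Nat.prime_three⟩
  rw [sigmaCongruenceAtThree_iff_invariantPair]
  intro W _ _ W' _ _ N N' _ _ K _ _ Dt Dt' hO6 hsurj hrk hN hmod haddv hN' hK hH hH' κ hκ γ _ 𝔭 h𝔭 hram
    hdeg 𝔭' h𝔭' hne ι' hι ΩK Ωp L hΩK hΩp hL ΩK' Ωp' L' hΩK' hΩp' hL' hi' T c hT hc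
  obtain ⟨m, hm⟩ := UniversalToricDescentSelfMuZero.exists_normProfile_of_exists_coeff_norm_eq_one
    (hM W N K Dt hO6 hsurj hrk hN hK hH κ hκ γ 𝔭 h𝔭 hram hdeg 𝔭' h𝔭' hne ι' hι ΩK Ωp L hΩK hΩp hL)
  obtain ⟨m', hm'⟩ := UniversalToricDescentSelfMuZero.exists_normProfile_of_exists_coeff_norm_eq_one hi'
  exact ⟨m, m', hm, hm', hΛ W W' N N' K Dt Dt' hO6 hsurj hrk hN hmod haddv hN' hK hH hH' κ hκ γ 𝔭 h𝔭 hram hdeg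
    𝔭' h𝔭' hne ι' hι ΩK Ωp L hΩK hΩp hL ΩK' Ωp' L' hΩK' hΩp' hL' hi' T c hT hc m m' hm hm'⟩

/-- **Granted M, A ⟺ Λ** — the tree's §5 with the print fact replaced by exactly what it is used for.
[cite: GreenbergVatsal2000, Thm. (1.5)] [cite: Hsieh2014, Thm. B (the source of M)] -/
theorem sigmaCongruenceAtThree_iff_lambdaIdentityAtThree_of_muZero (hM : WildFrameMuZeroAtThree) :
    SigmaCongruenceAtThree ↔ LambdaIdentityAtThree :=
  ⟨lambdaIdentityAtThree_of_sigmaCongruenceAtThree, sigmaCongruenceAtThree_of_muZero_of_lambdaIdentity hM⟩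

/-- **The audit's bottom line, by name:** given Hsieh Thm. B at every level (item 27933), A is EQUIVALENT to the
Σ-depleted λ-identity Λ; A is refutable only through Λ, and provable either through Λ (the port P2 of g15) or
vacuously through V. [cite: Hsieh2014, Thm. B p. 712 (Doc. Math. 19)] [cite: GreenbergVatsal2000, Thm. (1.5)] -/
theorem sigmaCongruenceAtThree_iff_lambdaIdentityAtThree_of_thmB
    (hB : Hsieh2014.thmB_exists_isHsiehLFunction_coeff_norm_eq_one_unrPeriod_anyLevel) :
    SigmaCongruenceAtThree ↔ LambdaIdentityAtThree :=
  sigmaCongruenceAtThree_iff_lambdaIdentityAtThree_of_muZero (wildFrameMuZeroAtThree_of_thmB hB)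

end Summit.BirchSwinnertonDyer.BirchSwinnertonDyer.Cruxes.SigmaCongruenceAtThree.WildFrameAudit

end
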